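import Summits.QuantumFields.YangMills.Theorems.FluctuationComparisonRegPrIntLS2BetaRhoAColumnCovers
import Summits.QuantumFields.YangMills.Theorems.FluctuationComparisonRegPrIntLS2BetaLiftLadderDiscRowTower
import Summits.QuantumFields.YangMills.Theorems.FluctuationComparisonRegPrIntLS2BetaLiftLadderFaceRow
import Literature.MathematicalPhysics.QuantumFieldTheory.Balaban1983to89.T4GnomonicWilsonHessian
import HarnessLib

/-!
# S2β · THE SUP CHAIN ∕ (D-stage) — THE `mA` COLUMN OF FILE P: the region letter `hmA` at an EXPLICIT `mA t B := (11∕10)·L⁻¹·mCA_par(t,B)` (parent feeder sup),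
# the feeder sup read by the parent box (common gauge + conjugation-invariant arc + ✓(k2′)), and the budget `Σ_t L^t·Σ_B mA² ≤ β_mA·S′`, `β_mA = (11∕10)²L⁻²(2d·13^d)L`

Cell `ym3-torus` (YM ladder rung R3 = continuum `SU(2)` Yang–Mills on the three-torus at fixed lattice data — a RUNG: NOT d = 4, NOT infinite volume,
NOT a mass gap, NOT Clay).  Width seat «width 21» `ym3-torus-px21` (gen 25), FREE px helper on crux `stmt-QuantumFields-20520`
(`…Theses.UnitScaleTilt.FluctuationComparisonRegPrIntL`), LINE g18-1 S2β.  px12 g26 2026-09-01 00:11:20Z: «the mA column is yours» (the ρ̃-budget assembly stays with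
px12 on my «px12 assembles»).  `--kind proof --supports stmt-QuantumFields-20520 --as helper`, count-neutral, DEFINITION-FREE (0 `def`, 0 `instance`, 0 `notation`,
0 `sorry`, default heartbeats).

WHAT IS PROVED (sorry-free).  ★★★`hmA_of_parentSup` (FILE P ✓p836058's `hmA` binder VERBATIM at the explicit dite'd `mA`; ✓`norm_logVec_liftChord_le_eleven_tenths` per bond),
★★★`mCApar_le_parentBoxSup` (the gauged feeder sup ≤ ✓p837136's parent-box Pi-sup of the level-`J+t` relative log field at radius 3: px16 ✓`stage_eq_gaugeAct_iter`,
✓`gaugeAct_mul_inv_gaugeAct`, lit `reTr_conj`∕`reTr_eq_re_su2Quat`∕`norm_logVec`, ✓`descendTo_apply_eq_iter_of_eq`, ρA-2 §1 geometry),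
★★★`mA_column_budget` (`Σ_t L^t Σ_B mA² ≤ ((11∕10)²·L⁻²·(2d·13^d)·L)·S′` by ✓(k2′) + ✓`mShare_le`).

HONEST SCOPE.  Plumbing + finite bookkeeping over landed letters; hat binders, (T3)×2, bottom relation, arcs, (E4) are HYPOTHESES; nothing of Bałaban's
renormalisation-group analysis is asserted or proved ([Balaban1985RegularSpaces] (1.29) p.81; [Balaban1985Averaging] (8)–(11) p.19, Prop. 4 (128)–(135) pp.37–38;
[Balaban1987RG1] (0.1)–(0.4), (0.11) pp.251–253); the ρ̃-budget assembly (sizes `sU aU sA aA`, FB-σ closed form), (SRC-P)∕G4-ii, `hArc`, (ST⁗)∕LOC⁗, GAP♯∘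
(`stub_uniformFibreGapOrbit`, registry 3732b7df UNTOUCHED), the five registered stubs (0∕5), S2β, 20520, 19936, 19200, `YM3TorusSU2` are NOT proved; no registered stub
is closed; rung R3 — NOT d = 4, NOT infinite volume, NOT a mass gap, NOT Clay; the Yang–Mills mass gap is NOT proved.
-/

set_option autoImplicit false

namespace Summit.QuantumFields.YangMills.Theorems.FluctuationComparisonRegPrIntLS2BetaMAColumn

open Finset
open scoped Real
open Literature.MathematicalPhysics.QuantumLattice (su2Quat)
open Literature.MathematicalPhysics.QuantumFieldTheory.Balaban1983to89
open T4Continuum T3ContinuumYM3Torus T3TiltDescent T3LevelShift BlockAveraging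
open B10Eq27TorusAxialLog (rel rel_apply rel_self)
open B14.Eq22Determines (blockIter)
open T4CubeChartGnomonic (SU2)
open T4HaarSU2ExpChart (expPoint)
open T4ExpWindowSmallField (logVec)
open T3UnitLawDensityEML (ℰp)
open T4ExpWindowSmallField (norm_logVec)
open T4GnomonicWilsonHessian (reTr_eq_re_su2Quat)
open B11GaugeGlue (dist1_inv_mul_eq)
open Summit.QuantumFields.YangMills.Theorems.FluctuationComparisonRegPrIntLS2BetaReadNesting (natAbs_rel_le_add natAbs_rel_comm)
open Summit.QuantumFields.YangMills.Theorems.FluctuationComparisonRegPrIntLS2BetaTorusCellClasses (natAbs_rel_blockOf_le)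
open Summit.QuantumFields.YangMills.Theorems.FluctuationComparisonRegPrIntLS2BetaLiftLadderCombRowTower (natAbs_rel_siteShift descendTo_apply_eq_iter_of_eq)
open Summit.QuantumFields.YangMills.Theorems.FluctuationComparisonRegPrIntLS2BetaBlockPairReadCover (natAbs_rel_of_boxBlock)
open Summit.QuantumFields.YangMills.Theorems.FluctuationComparisonRegPrIntLS2BetaGeodesicJensenLift (dist1_le_norm_logVec)
open Summit.QuantumFields.YangMills.Theorems.FluctuationComparisonRegPrIntLS2BetaKappaRatioTower (stage_eq_gaugeAct_iter)
open Summit.QuantumFields.YangMills.Theorems.Prop7CurvedJunctionCovariance (gaugeAct_mul_inv_gaugeAct)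
open Summit.QuantumFields.YangMills.Theorems.FluctuationComparisonRegPrIntLS2BetaLiftLadderFaceRow (norm_logVec_liftChord_le_eleven_tenths)
open Summit.QuantumFields.YangMills.Theorems.FluctuationComparisonRegPrIntLS2BetaLiftLadderDiscRowTower (mShare_le)
open Summit.QuantumFields.YangMills.Theorems.FluctuationComparisonRegPrIntLS2BetaParentBoxReadCover (sum_sq_parentBoxSup_le_readSup)
open Summit.QuantumFields.YangMills.Theorems.FluctuationComparisonRegPrIntLS2BetaRhoAColumnCovers (natAbs_rel_blockOf_le_one_of_wt natAbs_rel_corner_le_one)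

section Tower

variable {F : T3Family}

/-- ★★★ **THE `mA` REGION LETTER OF FILE P FROM THE PARENT FEEDER SUP** (px12 g26 2026-09-01 00:11:20Z «the mA column is yours»): under R′'s hat binders `hwt`, `hlift` and the
per-level parent arc letters `σ t ≤ 1∕4`, FILE P's `hmA` binder HOLDS (conclusion = ✓p836058 `rhoTilde_of_regionLetters`'s `hmA` text VERBATIM) at the EXPLICIT
`mA t B := if ht then (11∕10)·(L⁻¹·mCA_par(t,B)) else 0`, where `mCA_par(t,B)` is the Pi-sup of the GAUGED parent relative chords `‖logVec (X e·(X′ e)⁻¹)‖`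
(`X = g_{s+1}•Ū^{s+1}(e^ζU₀)`, `X′ = g₀_{s+1}•Ū^{s+1}U₁`) over the hat feeders `wt s b e ≠ 0` of the four bonds of the region plaquettes — px20's ✓p832421-engine numeric
edition ✓`norm_logVec_liftChord_le_eleven_tenths` per bond + ✓`dist1_le_norm_logVec` + the `(A_U b)⁻¹·A_W b ↦ A_W b·(A_U b)⁻¹` orientation flip. [cite: Balaban1985RegularSpaces, (1.29) p.81; Balaban1985Averaging, Prop. 4 (128)-(135) p.37-38] -/
theorem hmA_of_parentSup {J K : ℕ} (U₀ : GaugeField (F.P K) 0 (Matrix.specialUnitaryGroup (Fin 2) ℂ)) (ζ : PBond (F.P K) 0 → EuclideanSpace ℝ (Fin 3))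
    (wt : (j : ℕ) → PBond (F.P K) j → PBond (F.P K) (j + 1) → ℝ)
    (lift : (j : ℕ) → GaugeField (F.P K) (j + 1) SU2 → GaugeField (F.P K) j SU2)
    (U₁ : GaugeField (F.P K) 0 SU2) (g g₀ : (j : ℕ) → Site (F.P K) j → SU2)
    (hwt : ∀ j b e, wt j b e = if e.dir = b.dir ∧ (b.src b.dir - emb e.src b.dir).val < (F.P K).L then
        ∏ ν ∈ Finset.univ.erase b.dir, max 0 (1 - ((rel (emb e.src) b.src ν).natAbs : ℝ) / (F.P K).L) else 0) (hlift : ∀ j X b, lift j X b = expPoint (∑ e, wt j b e • ((((F.P K).L : ℕ) : ℝ)⁻¹ • logVec (su2Quat (X e)))))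
    (σ : ℕ → ℝ) (hσ4 : ∀ t, σ t ≤ 1 / 4)
    (hσ : ∀ (t : ℕ), t < K - J → ∀ e : PBond (F.P K) ((K - (J + (t + 1))) + 1), ‖logVec (su2Quat (GaugeField.gaugeAct (g ((K - (J + (t + 1))) + 1)) (Averaging.iter (fun k => blockAvg (P := F.P K) (j := k) ℰp) ((K - (J + (t + 1))) + 1) (fun ℓ => expPoint (ζ ℓ) * U₀ ℓ)) e))‖ ≤ σ t)
    (hσ' : ∀ (t : ℕ), t < K - J → ∀ e : PBond (F.P K) ((K - (J + (t + 1))) + 1), ‖logVec (su2Quat (GaugeField.gaugeAct (g₀ ((K - (J + (t + 1))) + 1)) (Averaging.iter (fun k => blockAvg (P := F.P K) (j := k) ℰp) ((K - (J + (t + 1))) + 1) U₁) e))‖ ≤ σ t) :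
    ∀ (t : ℕ) (ht : t < K - J) (B : PBond (F.P J) 0) (q : Plaq (F.P K) (K - (J + (t + 1)))),
      (∃ ℓ' : PBond (F.P (J + (t + 1))) 0, (∃ z : Site (F.P (J + (t + 1))) 0,
                (B14.Eq22Determines.blockIter (t + 1) z = (bondShift (F.sitesPerDir_eq (m := F.m) (K := J) (j := 0) (m' := F.m) (K' := J + (t + 1)) (j' := t + 1) (by omega)) B).src ∨ B14.Eq22Determines.blockIter (t + 1) z = (bondShift (F.sitesPerDir_eq (m := F.m) (K := J) (j := 0) (m' := F.m) (K' := J + (t + 1)) (j' := t + 1) (by omega)) B).tgt) ∧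
                ∀ ν, (B10Eq27TorusAxialLog.rel z ℓ'.src ν).natAbs ≤ 2) ∧
        (blockOf q.src = blockOf (bondShift (F.sitesPerDir_eq (m := F.m) (K := J + (t + 1)) (j := 0) (m' := F.m) (K' := K) (j' := (K - (J + (t + 1)))) (by omega)) ℓ').src ∨ blockOf q.src = (blockOf (bondShift (F.sitesPerDir_eq (m := F.m) (K := J + (t + 1)) (j := 0) (m' := F.m) (K' := K) (j' := (K - (J + (t + 1)))) (by omega)) ℓ').src).shift (bondShift (F.sitesPerDir_eq (m := F.m) (K := J + (t + 1)) (j := 0) (m' := F.m) (K' := K) (j' := (K - (J + (t + 1)))) (by omega)) ℓ').dir)) →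
      ∀ b : PBond (F.P K) (K - (J + (t + 1))), b = ⟨q.src, q.μ⟩ ∨ b = ⟨q.src.shift q.μ, q.ν⟩ ∨ b = ⟨q.src.shift q.ν, q.μ⟩ ∨ b = ⟨q.src, q.ν⟩ →
        dist1 ((lift (K - (J + (t + 1))) (GaugeField.gaugeAct (g₀ ((K - (J + (t + 1))) + 1)) (Averaging.iter (fun k => blockAvg (P := F.P K) (j := k) ℰp) ((K - (J + (t + 1))) + 1) U₁)) b)⁻¹ * lift (K - (J + (t + 1))) (GaugeField.gaugeAct (g ((K - (J + (t + 1))) + 1)) (Averaging.iter (fun k => blockAvg (P := F.P K) (j := k) ℰp) ((K - (J + (t + 1))) + 1) (fun ℓ => expPoint (ζ ℓ) * U₀ ℓ))) b) ≤ (fun (t : ℕ) (B : PBond (F.P J) 0) => if ht : t < K - J then 11 / 10 * (((F.P K).L : ℝ)⁻¹ * ‖(fun e : PBond (F.P K) ((K - (J + (t + 1))) + 1) => if (∃ q : Plaq (F.P K) (K - (J + (t + 1))), ((∃ ℓ' : PBond (F.P (J + (t + 1))) 0, (∃ z : Site (F.P (J + (t + 1))) 0,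
                (B14.Eq22Determines.blockIter (t + 1) z = (bondShift (F.sitesPerDir_eq (m := F.m) (K := J) (j := 0) (m' := F.m) (K' := J + (t + 1)) (j' := t + 1) (by omega)) B).src ∨ B14.Eq22Determines.blockIter (t + 1) z = (bondShift (F.sitesPerDir_eq (m := F.m) (K := J) (j := 0) (m' := F.m) (K' := J + (t + 1)) (j' := t + 1) (by omega)) B).tgt) ∧
                ∀ ν, (B10Eq27TorusAxialLog.rel z ℓ'.src ν).natAbs ≤ 2) ∧
        (blockOf q.src = blockOf (bondShift (F.sitesPerDir_eq (m := F.m) (K := J + (t + 1)) (j := 0) (m' := F.m) (K' := K) (j' := (K - (J + (t + 1)))) (by omega)) ℓ').src ∨ blockOf q.src = (blockOf (bondShift (F.sitesPerDir_eq (m := F.m) (K := J + (t + 1)) (j := 0) (m' := F.m) (K' := K) (j' := (K - (J + (t + 1)))) (by omega)) ℓ').src).shift (bondShift (F.sitesPerDir_eq (m := F.m) (K := J + (t + 1)) (j := 0) (m' := F.m) (K' := K) (j' := (K - (J + (t + 1)))) (by omega)) ℓ').dir))) ∧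
          ∃ b : PBond (F.P K) (K - (J + (t + 1))), (b = ⟨q.src, q.μ⟩ ∨ b = ⟨q.src.shift q.μ, q.ν⟩ ∨ b = ⟨q.src.shift q.ν, q.μ⟩ ∨ b = ⟨q.src, q.ν⟩) ∧ wt (K - (J + (t + 1))) b e ≠ 0) then ‖logVec (su2Quat (GaugeField.gaugeAct (g ((K - (J + (t + 1))) + 1)) (Averaging.iter (fun k => blockAvg (P := F.P K) (j := k) ℰp) ((K - (J + (t + 1))) + 1) (fun ℓ => expPoint (ζ ℓ) * U₀ ℓ)) e * (GaugeField.gaugeAct (g₀ ((K - (J + (t + 1))) + 1)) (Averaging.iter (fun k => blockAvg (P := F.P K) (j := k) ℰp) ((K - (J + (t + 1))) + 1) U₁) e)⁻¹))‖ else 0)‖) else 0) t B := by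
  intro t ht B q hreg b hb
  have hs1 : (K - (J + (t + 1))) + 1 ≤ (F.P K).m + (F.P K).K := by show (K - (J + (t + 1))) + 1 ≤ F.m + K; omega
  have hL2 : 2 ≤ (F.P K).L := by show 2 ≤ F.L; have := F.hL; omega
  simp only [dif_pos ht]
  -- orientation flip and chord ≤ arc
  have hflip : dist1 ((lift (K - (J + (t + 1))) (GaugeField.gaugeAct (g₀ ((K - (J + (t + 1))) + 1)) (Averaging.iter (fun k => blockAvg (P := F.P K) (j := k) ℰp) ((K - (J + (t + 1))) + 1) U₁)) b)⁻¹ * lift (K - (J + (t + 1))) (GaugeField.gaugeAct (g ((K - (J + (t + 1))) + 1)) (Averaging.iter (fun k => blockAvg (P := F.P K) (j := k) ℰp) ((K - (J + (t + 1))) + 1) (fun ℓ => expPoint (ζ ℓ) * U₀ ℓ))) b) = dist1 (lift (K - (J + (t + 1))) (GaugeField.gaugeAct (g ((K - (J + (t + 1))) + 1)) (Averaging.iter (fun k => blockAvg (P := F.P K) (j := k) ℰp) ((K - (J + (t + 1))) + 1) (fun ℓ => expPoint (ζ ℓ) * U₀ ℓ))) b * (lift (K - (J + (t + 1))) (GaugeField.gaugeAct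 (g₀ ((K - (J + (t + 1))) + 1)) (Averaging.iter (fun k => blockAvg (P := F.P K) (j := k) ℰp) ((K - (J + (t + 1))) + 1) U₁)) b)⁻¹) := by
    rw [dist1_inv_mul_eq, ← GaugeGroup.dist1_inv, mul_inv_rev, inv_inv]
  rw [hflip]
  refine (dist1_le_norm_logVec _).trans ?_
  refine norm_logVec_liftChord_le_eleven_tenths hs1 (wt (K - (J + (t + 1)))) (hwt (K - (J + (t + 1)))) (GaugeField.gaugeAct (g ((K - (J + (t + 1))) + 1)) (Averaging.iter (fun k => blockAvg (P := F.P K) (j := k) ℰp) ((K - (J + (t + 1))) + 1) (fun ℓ => expPoint (ζ ℓ) * U₀ ℓ))) (GaugeField.gaugeAct (g₀ ((K - (J + (t + 1))) + 1)) (Averaging.iter (fun k => blockAvg (P := F.P K) (j := k) ℰp) ((K - (J + (t + 1))) + 1) U₁)) (lift (K - (J + (t + 1))) (GaugeField.gaugeAct (g ((K - (J + (t + 1))) + 1)) (Averaging.iter (fun k => blockAvg (P := F.P K) (j := k) ℰp) ((K - (J + (t + 1))) + 1) (fun ℓ => expPoint (ζ ℓ) * U₀ ℓ)))) (lift (K -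 (J + (t + 1))) (GaugeField.gaugeAct (g₀ ((K - (J + (t + 1))) + 1)) (Averaging.iter (fun k => blockAvg (P := F.P K) (j := k) ℰp) ((K - (J + (t + 1))) + 1) U₁)))
    (fun b => hlift (K - (J + (t + 1))) _ b) (fun b => hlift (K - (J + (t + 1))) _ b) b hL2 (hσ4 t) (fun e _ => hσ t ht e) (fun e _ => hσ' t ht e) ?_
  intro e he
  refine le_trans ?_ (norm_le_pi_norm _ e)
  rw [if_pos ⟨q, hreg, b, hb, he⟩, Real.norm_of_nonneg (norm_nonneg _)]

/-- ★★★ **`mCA_par(t,B) ≤ ‖𝟙[PBOX³_t(B)]·η_{J+t}‖`** — the gauged feeder sup is read by the parent box of ✓p837136 (k2′) at radius `3` with `g := η_{J+t}` (px20's `M` integrand):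
COMMON GAUGE `g₀_{s+1}•Ū^{s+1}U₁ = g_{s+1}•Ū^{s+1}U₀` (px16 ✓`stage_eq_gaugeAct_iter` from (T3)×2 + the bottom relation), the relative chord is CONJUGATED at the source
(✓`gaugeAct_mul_inv_gaugeAct`) and the arc is conjugation-invariant (`‖logVec‖ = arccos ∘ reTr`, lit ✓`reTr_conj`); then `Ū^{s+1}X e = D_{J+t,K}X(σ⁻¹e)` and the feeder geometry
of ✓p838235 ρA-2 §1.  Hence `Σ_B mCA_par(t,B)² ≤ (2d·13^d)·Σ_B M(t,B)²` and ✓`mShare_le`. [cite: Balaban1987RG1, (0.1)-(0.4), (0.11) p.251-253; Balaban1985Averaging, (8)-(11) p.19] -/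
theorem mCApar_le_parentBoxSup {J K : ℕ} (U₀ : GaugeField (F.P K) 0 (Matrix.specialUnitaryGroup (Fin 2) ℂ)) (ζ : PBond (F.P K) 0 → EuclideanSpace ℝ (Fin 3))
    (wt : (j : ℕ) → PBond (F.P K) j → PBond (F.P K) (j + 1) → ℝ)
    (U₁ : GaugeField (F.P K) 0 SU2) (g g₀ : (j : ℕ) → Site (F.P K) j → SU2)
    (hwt : ∀ j b e, wt j b e = if e.dir = b.dir ∧ (b.src b.dir - emb e.src b.dir).val < (F.P K).L then
        ∏ ν ∈ Finset.univ.erase b.dir, max 0 (1 - ((rel (emb e.src) b.src ν).natAbs : ℝ) / (F.P K).L) else 0) (hT3 : ∀ X : GaugeField (F.P K) 0 SU2, ∀ j, j ≤ K - J →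
      Averaging.iter (fun k => blockAvg (P := F.P K) (j := k) ℰp) j (GaugeField.gaugeAct (g 0) X) =
        GaugeField.gaugeAct (g j) (Averaging.iter (fun k => blockAvg (P := F.P K) (j := k) ℰp) j X)) (hT3' : ∀ X : GaugeField (F.P K) 0 SU2, ∀ j, j ≤ K - J →
      Averaging.iter (fun k => blockAvg (P := F.P K) (j := k) ℰp) j (GaugeField.gaugeAct (g₀ 0) X) =
        GaugeField.gaugeAct (g₀ j) (Averaging.iter (fun k => blockAvg (P := F.P K) (j := k) ℰp) j X)) (hU₀ : U₀ = GaugeField.gaugeAct (fun x => (g 0 x)⁻¹ * g₀ 0 x) U₁)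
    (t : ℕ) (ht : t < K - J) (B : PBond (F.P J) 0) :
    ‖(fun e : PBond (F.P K) ((K - (J + (t + 1))) + 1) => if (∃ q : Plaq (F.P K) (K - (J + (t + 1))), ((∃ ℓ' : PBond (F.P (J + (t + 1))) 0, (∃ z : Site (F.P (J + (t + 1))) 0,
                (B14.Eq22Determines.blockIter (t + 1) z = (bondShift (F.sitesPerDir_eq (m := F.m) (K := J) (j := 0) (m' := F.m) (K' := J + (t + 1)) (j' := t + 1) (by omega)) B).src ∨ B14.Eq22Determines.blockIter (t + 1) z = (bondShift (F.sitesPerDir_eq (m := F.m) (K := J) (j := 0) (m' := F.m) (K' := J + (t + 1)) (j' := t + 1) (by omega)) B).tgt) ∧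
                ∀ ν, (B10Eq27TorusAxialLog.rel z ℓ'.src ν).natAbs ≤ 2) ∧
        (blockOf q.src = blockOf (bondShift (F.sitesPerDir_eq (m := F.m) (K := J + (t + 1)) (j := 0) (m' := F.m) (K' := K) (j' := (K - (J + (t + 1)))) (by omega)) ℓ').src ∨ blockOf q.src = (blockOf (bondShift (F.sitesPerDir_eq (m := F.m) (K := J + (t + 1)) (j := 0) (m' := F.m) (K' := K) (j' := (K - (J + (t + 1)))) (by omega)) ℓ').src).shift (bondShift (F.sitesPerDir_eq (m := F.m) (K := J + (t + 1)) (j := 0) (m' := F.m) (K' := K) (j' := (K - (J + (t + 1)))) (by omega)) ℓ').dir))) ∧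
          ∃ b : PBond (F.P K) (K - (J + (t + 1))), (b = ⟨q.src, q.μ⟩ ∨ b = ⟨q.src.shift q.μ, q.ν⟩ ∨ b = ⟨q.src.shift q.ν, q.μ⟩ ∨ b = ⟨q.src, q.ν⟩) ∧ wt (K - (J + (t + 1))) b e ≠ 0) then ‖logVec (su2Quat (GaugeField.gaugeAct (g ((K - (J + (t + 1))) + 1)) (Averaging.iter (fun k => blockAvg (P := F.P K) (j := k) ℰp) ((K - (J + (t + 1))) + 1) (fun ℓ => expPoint (ζ ℓ) * U₀ ℓ)) e * (GaugeField.gaugeAct (g₀ ((K - (J + (t + 1))) + 1)) (Averaging.iter (fun k => blockAvg (P := F.P K) (j := k) ℰp) ((K - (J + (t + 1))) + 1) U₁) e)⁻¹))‖ else 0)‖ ≤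
      ‖(fun c : PBond (F.P (J + t)) 0 =>
        if ∃ ℓ' : PBond (F.P (J + (t + 1))) 0, (∃ ℓ'' : PBond (F.P (J + (t + 1))) 0, (∃ z : Site (F.P (J + (t + 1))) 0,
                (B14.Eq22Determines.blockIter (t + 1) z = (bondShift (F.sitesPerDir_eq (m := F.m) (K := J) (j := 0) (m' := F.m) (K' := J + (t + 1)) (j' := t + 1) (by omega)) B).src ∨ B14.Eq22Determines.blockIter (t + 1) z = (bondShift (F.sitesPerDir_eq (m := F.m) (K := J) (j := 0) (m' := F.m) (K' := J + (t + 1)) (j' := t + 1) (by omega)) B).tgt) ∧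
                ∀ ν, (B10Eq27TorusAxialLog.rel z ℓ''.src ν).natAbs ≤ 2) ∧
                (blockOf ℓ'.src = (blockOf ℓ''.src).unshift ℓ''.dir ∨ blockOf ℓ'.src = blockOf ℓ''.src ∨ blockOf ℓ'.src = (blockOf ℓ''.src).shift ℓ''.dir)) ∧
                ∀ ν, (B10Eq27TorusAxialLog.rel ((siteShift (F.sitesPerDir_eq (m := F.m) (K := J + t) (j := 0) (m' := F.m) (K' := J + (t + 1)) (j' := 1) (by omega))).symm (blockOf ℓ'.src)) c.src ν).natAbs ≤ 3
        then logVec (su2Quat (descendTo F ℰp (J + t) K (by omega) (fun ℓ => expPoint (ζ ℓ) * U₀ ℓ : GaugeField (F.P K) 0 (Matrix.specialUnitaryGroup (Fin 2) ℂ)) c * (descendTo F ℰp (J + t) K (by omega) U₀ c)⁻¹)) else 0)‖ := by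
  classical
  have hs1 : (K - (J + (t + 1))) + 1 ≤ (F.P K).m + (F.P K).K := by show (K - (J + (t + 1))) + 1 ≤ F.m + K; omega
  have ha : (K - (J + (t + 1))) + 1 = K - (J + t) := by omega
  have hJt : J + t ≤ K := by omega
  have Pσ : (F.P (J + t)).sitesPerDir 0 = (F.P K).sitesPerDir ((K - (J + (t + 1))) + 1) := F.sitesPerDir_eq (by omega)
  have H : (F.P (J + t)).sitesPerDir 0 = (F.P (J + (t + 1))).sitesPerDir 1 := F.sitesPerDir_eq (by omega)
  have H₁ : (F.P (J + (t + 1))).sitesPerDir 1 = (F.P K).sitesPerDir ((K - (J + (t + 1))) + 1) := F.sitesPerDir_eq (by omega)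
  have P₂ : (F.P (J + (t + 1))).sitesPerDir 0 = (F.P K).sitesPerDir (K - (J + (t + 1))) := F.sitesPerDir_eq (by omega)
  -- the common gauge: the two gauged parents are `g_{s+1} • (raw parents)`
  have hXU : GaugeField.gaugeAct (g₀ ((K - (J + (t + 1))) + 1)) (Averaging.iter (fun k => blockAvg (P := F.P K) (j := k) ℰp) ((K - (J + (t + 1))) + 1) U₁) = GaugeField.gaugeAct (g ((K - (J + (t + 1))) + 1)) (Averaging.iter (fun k => blockAvg (P := F.P K) (j := k) ℰp) ((K - (J + (t + 1))) + 1) U₀) :=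
    stage_eq_gaugeAct_iter (fun k => blockAvg (P := F.P K) (j := k) ℰp) g g₀ U₁ U₀ (fun X => hT3 X _ (by omega)) (fun X => hT3' X _ (by omega)) hU₀
  refine (pi_norm_le_iff_of_nonneg (norm_nonneg _)).mpr fun e => ?_
  by_cases hs : (∃ q : Plaq (F.P K) (K - (J + (t + 1))), ((∃ ℓ' : PBond (F.P (J + (t + 1))) 0, (∃ z : Site (F.P (J + (t + 1))) 0,
                (B14.Eq22Determines.blockIter (t + 1) z = (bondShift (F.sitesPerDir_eq (m := F.m) (K := J) (j := 0) (m' := F.m) (K' := J + (t + 1)) (j' := t + 1) (by omega)) B).src ∨ B14.Eq22Determines.blockIter (t + 1) z = (bondShift (F.sitesPerDir_eq (m := F.m) (K := J) (j := 0) (m' := F.m) (K' := J + (t + 1)) (j' := t + 1) (by omega)) B).tgt) ∧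
                ∀ ν, (B10Eq27TorusAxialLog.rel z ℓ'.src ν).natAbs ≤ 2) ∧
        (blockOf q.src = blockOf (bondShift (F.sitesPerDir_eq (m := F.m) (K := J + (t + 1)) (j := 0) (m' := F.m) (K' := K) (j' := (K - (J + (t + 1)))) (by omega)) ℓ').src ∨ blockOf q.src = (blockOf (bondShift (F.sitesPerDir_eq (m := F.m) (K := J + (t + 1)) (j := 0) (m' := F.m) (K' := K) (j' := (K - (J + (t + 1)))) (by omega)) ℓ').src).shift (bondShift (F.sitesPerDir_eq (m := F.m) (K := J + (t + 1)) (j := 0) (m' := F.m) (K' := K) (j' := (K - (J + (t + 1)))) (by omega)) ℓ').dir))) ∧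
          ∃ b : PBond (F.P K) (K - (J + (t + 1))), (b = ⟨q.src, q.μ⟩ ∨ b = ⟨q.src.shift q.μ, q.ν⟩ ∨ b = ⟨q.src.shift q.ν, q.μ⟩ ∨ b = ⟨q.src, q.ν⟩) ∧ wt (K - (J + (t + 1))) b e ≠ 0)
  · rw [if_pos hs, Real.norm_of_nonneg (norm_nonneg _)]
    obtain ⟨q, ⟨ℓr, hread, hreg⟩, b, hb, hbe⟩ := hs
    -- GEOMETRY (as in ρA-2): the feeder is within `3` of the box block
    have hY : ∀ κ, (rel (blockOf (bondShift (F.sitesPerDir_eq (m := F.m) (K := J + (t + 1)) (j := 0) (m' := F.m) (K' := K) (j' := (K - (J + (t + 1)))) (by omega)) ℓr).src) e.src κ).natAbs ≤ 3 := by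
      intro κ
      have h1 : (rel (blockOf (bondShift (F.sitesPerDir_eq (m := F.m) (K := J + (t + 1)) (j := 0) (m' := F.m) (K' := K) (j' := (K - (J + (t + 1)))) (by omega)) ℓr).src) (blockOf q.src) κ).natAbs ≤ 1 :=
        natAbs_rel_of_boxBlock _ _ (bondShift (F.sitesPerDir_eq (m := F.m) (K := J + (t + 1)) (j := 0) (m' := F.m) (K' := K) (j' := (K - (J + (t + 1)))) (by omega)) ℓr).dir (by
          rcases hreg with h | h
          · exact Or.inr (Or.inl h)
          · exact Or.inr (Or.inr h)) κ
      have hqb : (rel (blockOf q.src) (blockOf b.src) κ).natAbs ≤ 1 := by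
        have hsrc : b.src = q.src ∨ b.src = q.src.shift q.μ ∨ b.src = q.src.shift q.ν := by
          rcases hb with h | h | h | h
          · subst h; exact Or.inl rfl
          · subst h; exact Or.inr (Or.inl rfl)
          · subst h; exact Or.inr (Or.inr rfl)
          · subst h; exact Or.inl rfl
        exact natAbs_rel_blockOf_le hs1 _ _ κ (natAbs_rel_corner_le_one q.src q.μ q.ν hsrc κ)
      have hbe' : (rel (blockOf b.src) e.src κ).natAbs ≤ 1 := by
        rw [natAbs_rel_comm]; exact natAbs_rel_blockOf_le_one_of_wt hs1 (wt (K - (J + (t + 1)))) (hwt (K - (J + (t + 1)))) hbe κ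
      have h2 : (rel (blockOf q.src) e.src κ).natAbs ≤ 2 := (natAbs_rel_le_add _ (blockOf b.src) _ κ).trans (Nat.add_le_add hqb hbe')
      exact (natAbs_rel_le_add _ (blockOf q.src) _ κ).trans (Nat.add_le_add h1 h2)
    -- the level-`J+t` copy `c` of `e` and its parent-box membership
    set c : PBond (F.P (J + t)) 0 := (bondShift Pσ).symm e with hc
    have hce : bondShift Pσ c = e := (bondShift Pσ).apply_symm_apply e
    have hbox : ∃ ℓ' : PBond (F.P (J + (t + 1))) 0, (∃ ℓ'' : PBond (F.P (J + (t + 1))) 0, (∃ z : Site (F.P (J + (t + 1))) 0,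
                (B14.Eq22Determines.blockIter (t + 1) z = (bondShift (F.sitesPerDir_eq (m := F.m) (K := J) (j := 0) (m' := F.m) (K' := J + (t + 1)) (j' := t + 1) (by omega)) B).src ∨ B14.Eq22Determines.blockIter (t + 1) z = (bondShift (F.sitesPerDir_eq (m := F.m) (K := J) (j := 0) (m' := F.m) (K' := J + (t + 1)) (j' := t + 1) (by omega)) B).tgt) ∧
                ∀ ν, (B10Eq27TorusAxialLog.rel z ℓ''.src ν).natAbs ≤ 2) ∧
                (blockOf ℓ'.src = (blockOf ℓ''.src).unshift ℓ''.dir ∨ blockOf ℓ'.src = blockOf ℓ''.src ∨ blockOf ℓ'.src = (blockOf ℓ''.src).shift ℓ''.dir)) ∧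
                ∀ ν, (B10Eq27TorusAxialLog.rel ((siteShift (F.sitesPerDir_eq (m := F.m) (K := J + t) (j := 0) (m' := F.m) (K' := J + (t + 1)) (j' := 1) (by omega))).symm (blockOf ℓ'.src)) c.src ν).natAbs ≤ 3 := by
      refine ⟨ℓr, ⟨ℓr, hread, Or.inr (Or.inl rfl)⟩, fun ν => ?_⟩
      have e1 := natAbs_rel_siteShift Pσ ((siteShift H).symm (blockOf ℓr.src)) c.src ν
      have e2 : siteShift Pσ c.src = e.src := by
        show siteShift Pσ ((siteShift Pσ).symm e.src) = e.src
        exact (siteShift Pσ).apply_symm_apply e.src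
      have e3 : siteShift Pσ ((siteShift H).symm (blockOf ℓr.src)) = blockOf (bondShift (F.sitesPerDir_eq (m := F.m) (K := J + (t + 1)) (j := 0) (m' := F.m) (K' := K) (j' := (K - (J + (t + 1)))) (by omega)) ℓr).src := by
        rw [bondShift_src, ← siteShift_blockOf P₂ H₁]
        conv_rhs => rw [← (siteShift H).apply_symm_apply (blockOf ℓr.src)]
        rw [siteShift_siteShift]
      rw [e2, e3] at e1
      exact e1.symm.le.trans (hY ν)
    -- CURRENCY: common gauge ⇒ conjugated raw relative chord ⇒ same arc ⇒ the level-`J+t` relative log field at `c`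
    have hcur : ‖logVec (su2Quat (GaugeField.gaugeAct (g ((K - (J + (t + 1))) + 1)) (Averaging.iter (fun k => blockAvg (P := F.P K) (j := k) ℰp) ((K - (J + (t + 1))) + 1) (fun ℓ => expPoint (ζ ℓ) * U₀ ℓ)) e * (GaugeField.gaugeAct (g₀ ((K - (J + (t + 1))) + 1)) (Averaging.iter (fun k => blockAvg (P := F.P K) (j := k) ℰp) ((K - (J + (t + 1))) + 1) U₁) e)⁻¹))‖ = ‖logVec (su2Quat (descendTo F ℰp (J + t) K (by omega) (fun ℓ => expPoint (ζ ℓ) * U₀ ℓ : GaugeField (F.P K) 0 (Matrix.specialUnitaryGroup (Fin 2) ℂ)) c * (descendTo F ℰp (J + t) K (by omega) U₀ c)⁻¹))‖ := by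
      rw [hXU, gaugeAct_mul_inv_gaugeAct, norm_logVec, norm_logVec, ← reTr_eq_re_su2Quat, ← reTr_eq_re_su2Quat, GaugeGroup.reTr_conj,
        descendTo_apply_eq_iter_of_eq F hJt ha, descendTo_apply_eq_iter_of_eq F hJt ha, hce]
    rw [hcur]
    have := norm_le_pi_norm (fun c : PBond (F.P (J + t)) 0 =>
        if ∃ ℓ' : PBond (F.P (J + (t + 1))) 0, (∃ ℓ'' : PBond (F.P (J + (t + 1))) 0, (∃ z : Site (F.P (J + (t + 1))) 0,
                (B14.Eq22Determines.blockIter (t + 1) z = (bondShift (F.sitesPerDir_eq (m := F.m) (K := J) (j := 0) (m' := F.m) (K' := J + (t + 1)) (j' := t + 1) (by omega)) B).src ∨ B14.Eq22Determines.blockIter (t + 1) z = (bondShift (F.sitesPerDir_eq (m := F.m) (K := J) (j := 0) (m' := F.m) (K' := J + (t + 1)) (j' := t + 1) (by omega)) B).tgt) ∧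
                ∀ ν, (B10Eq27TorusAxialLog.rel z ℓ''.src ν).natAbs ≤ 2) ∧
                (blockOf ℓ'.src = (blockOf ℓ''.src).unshift ℓ''.dir ∨ blockOf ℓ'.src = blockOf ℓ''.src ∨ blockOf ℓ'.src = (blockOf ℓ''.src).shift ℓ''.dir)) ∧
                ∀ ν, (B10Eq27TorusAxialLog.rel ((siteShift (F.sitesPerDir_eq (m := F.m) (K := J + t) (j := 0) (m' := F.m) (K' := J + (t + 1)) (j' := 1) (by omega))).symm (blockOf ℓ'.src)) c.src ν).natAbs ≤ 3
        then logVec (su2Quat (descendTo F ℰp (J + t) K (by omega) (fun ℓ => expPoint (ζ ℓ) * U₀ ℓ : GaugeField (F.P K) 0 (Matrix.specialUnitaryGroup (Fin 2) ℂ)) c * (descendTo F ℰp (J + t) K (by omega) U₀ c)⁻¹)) else 0) c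
    rwa [if_pos hbox] at this
  · rw [if_neg hs, norm_zero]; exact norm_nonneg _

/-- ★★★ **THE `mA`-COLUMN BUDGET**: `Σ_{t<K−J} L^t·Σ_B mA(t,B)² ≤ β_mA·S′` with `β_mA := (11∕10)²·L⁻²·(2d·13^d)·L` — a PURE `S′`-share (no purse term): §2 + ✓p837136 (k2′) at `r = 3` +
px20's ✓`mShare_le` (the fibre mate (E4) `hmate` pays the `t ↦ t+1` shift).  In FILE P this column enters as `2(4sU + aU)·mA + 2(4sA + aA)·mA` — the σ-class products of
RULING «FB-σ»; the ρ̃-budget assembler multiplies `β_mA` by those squared size letters. [cite: Balaban1985Averaging, Prop. 4 (128)-(135) p.37-38; Balaban1985RegularSpaces, (1.29) p.81] -/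
theorem mA_column_budget {J K : ℕ} (hJK : J ≤ K) (U₀ : GaugeField (F.P K) 0 (Matrix.specialUnitaryGroup (Fin 2) ℂ)) (ζ : PBond (F.P K) 0 → EuclideanSpace ℝ (Fin 3))
    (wt : (j : ℕ) → PBond (F.P K) j → PBond (F.P K) (j + 1) → ℝ)
    (U₁ : GaugeField (F.P K) 0 SU2) (g g₀ : (j : ℕ) → Site (F.P K) j → SU2)
    (hwt : ∀ j b e, wt j b e = if e.dir = b.dir ∧ (b.src b.dir - emb e.src b.dir).val < (F.P K).L then
        ∏ ν ∈ Finset.univ.erase b.dir, max 0 (1 - ((rel (emb e.src) b.src ν).natAbs : ℝ) / (F.P K).L) else 0) (hT3 : ∀ X : GaugeField (F.P K) 0 SU2, ∀ j, j ≤ K - J →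
      Averaging.iter (fun k => blockAvg (P := F.P K) (j := k) ℰp) j (GaugeField.gaugeAct (g 0) X) =
        GaugeField.gaugeAct (g j) (Averaging.iter (fun k => blockAvg (P := F.P K) (j := k) ℰp) j X)) (hT3' : ∀ X : GaugeField (F.P K) 0 SU2, ∀ j, j ≤ K - J →
      Averaging.iter (fun k => blockAvg (P := F.P K) (j := k) ℰp) j (GaugeField.gaugeAct (g₀ 0) X) =
        GaugeField.gaugeAct (g₀ j) (Averaging.iter (fun k => blockAvg (P := F.P K) (j := k) ℰp) j X)) (hU₀ : U₀ = GaugeField.gaugeAct (fun x => (g 0 x)⁻¹ * g₀ 0 x) U₁)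
    (hmate : descendTo F ℰp J K hJK (fun ℓ => expPoint (ζ ℓ) * U₀ ℓ : GaugeField (F.P K) 0 (Matrix.specialUnitaryGroup (Fin 2) ℂ)) = descendTo F ℰp J K hJK U₀) :
    ∑ t ∈ Finset.range (K - J), (F.L : ℝ) ^ t * ∑ B : PBond (F.P J) 0, ((fun (t : ℕ) (B : PBond (F.P J) 0) => if ht : t < K - J then 11 / 10 * (((F.P K).L : ℝ)⁻¹ * ‖(fun e : PBond (F.P K) ((K - (J + (t + 1))) + 1) => if (∃ q : Plaq (F.P K) (K - (J + (t + 1))), ((∃ ℓ' : PBond (F.P (J + (t + 1))) 0, (∃ z : Site (F.P (J + (t + 1))) 0,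
                (B14.Eq22Determines.blockIter (t + 1) z = (bondShift (F.sitesPerDir_eq (m := F.m) (K := J) (j := 0) (m' := F.m) (K' := J + (t + 1)) (j' := t + 1) (by omega)) B).src ∨ B14.Eq22Determines.blockIter (t + 1) z = (bondShift (F.sitesPerDir_eq (m := F.m) (K := J) (j := 0) (m' := F.m) (K' := J + (t + 1)) (j' := t + 1) (by omega)) B).tgt) ∧
                ∀ ν, (B10Eq27TorusAxialLog.rel z ℓ'.src ν).natAbs ≤ 2) ∧
        (blockOf q.src = blockOf (bondShift (F.sitesPerDir_eq (m := F.m) (K := J + (t + 1)) (j := 0) (m' := F.m) (K' := K) (j' := (K - (J + (t + 1)))) (by omega)) ℓ').src ∨ blockOf q.src = (blockOf (bondShift (F.sitesPerDir_eq (m := F.m) (K := J + (t + 1)) (j := 0) (m' := F.m) (K' := K) (j' := (K - (J + (t + 1)))) (by omega)) ℓ').src).shift (bondShift (F.sitesPerDir_eq (m := F.m) (K := J + (t + 1)) (j := 0) (m' := F.m) (K' := K) (j' := (K - (J + (t + 1)))) (by omega)) ℓ').dir))) ∧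
          ∃ b : PBond (F.P K) (K - (J + (t + 1))), (b = ⟨q.src, q.μ⟩ ∨ b = ⟨q.src.shift q.μ, q.ν⟩ ∨ b = ⟨q.src.shift q.ν, q.μ⟩ ∨ b = ⟨q.src, q.ν⟩) ∧ wt (K - (J + (t + 1))) b e ≠ 0) then ‖logVec (su2Quat (GaugeField.gaugeAct (g ((K - (J + (t + 1))) + 1)) (Averaging.iter (fun k => blockAvg (P := F.P K) (j := k) ℰp) ((K - (J + (t + 1))) + 1) (fun ℓ => expPoint (ζ ℓ) * U₀ ℓ)) e * (GaugeField.gaugeAct (g₀ ((K - (J + (t + 1))) + 1)) (Averaging.iter (fun k => blockAvg (P := F.P K) (j := k) ℰp) ((K - (J + (t + 1))) + 1) U₁) e)⁻¹))‖ else 0)‖) else 0) t B) ^ 2 ≤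
      ((11 / 10) ^ 2 * (((F.P K).L : ℝ)⁻¹) ^ 2 * ((2 * (F.P J).d * (2 * (3 + 3) + 1) ^ (F.P J).d : ℕ) : ℝ) * (F.L : ℝ)) * (∑ t ∈ Finset.range (K - J), (if ht : t < K - J then
          (F.L : ℝ) ^ t * ∑ B : PBond (F.P J) 0,
            ‖(fun ℓ' : PBond (F.P (J + (t + 1))) 0 =>
              if ∃ z : Site (F.P (J + (t + 1))) 0,
                (B14.Eq22Determines.blockIter (t + 1) z = (bondShift (F.sitesPerDir_eq (m := F.m) (K := J) (j := 0) (m' := F.m) (K' := J + (t + 1)) (j' := t + 1) (by omega)) B).src ∨ B14.Eq22Determines.blockIter (t + 1) z = (bondShift (F.sitesPerDir_eq (m := F.m) (K := J) (j := 0) (m' := F.m) (K' := J + (t + 1)) (j' := t + 1) (by omega)) B).tgt) ∧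
                ∀ ν, (B10Eq27TorusAxialLog.rel z ℓ'.src ν).natAbs ≤ 2
              then logVec (su2Quat (descendTo F ℰp (J + (t + 1)) K (by omega) (fun ℓ => expPoint (ζ ℓ) * U₀ ℓ : GaugeField (F.P K) 0 (Matrix.specialUnitaryGroup (Fin 2) ℂ)) ℓ' * (descendTo F ℰp (J + (t + 1)) K (by omega) U₀ ℓ')⁻¹)) else 0)‖ ^ 2
        else 0)) := by
  classical
  have hCA3 : (0 : ℝ) ≤ ((2 * (F.P J).d * (2 * (3 + 3) + 1) ^ (F.P J).d : ℕ) : ℝ) := by positivity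
  have hlev : ∀ t ∈ Finset.range (K - J),
      (F.L : ℝ) ^ t * ∑ B : PBond (F.P J) 0, ((fun (t : ℕ) (B : PBond (F.P J) 0) => if ht : t < K - J then 11 / 10 * (((F.P K).L : ℝ)⁻¹ * ‖(fun e : PBond (F.P K) ((K - (J + (t + 1))) + 1) => if (∃ q : Plaq (F.P K) (K - (J + (t + 1))), ((∃ ℓ' : PBond (F.P (J + (t + 1))) 0, (∃ z : Site (F.P (J + (t + 1))) 0,
                (B14.Eq22Determines.blockIter (t + 1) z = (bondShift (F.sitesPerDir_eq (m := F.m) (K := J) (j := 0) (m' := F.m) (K' := J + (t + 1)) (j' := t + 1) (by omega)) B).src ∨ B14.Eq22Determines.blockIter (t + 1) z = (bondShift (F.sitesPerDir_eq (m := F.m) (K := J) (j := 0) (m' := F.m) (K' := J + (t + 1)) (j' := t + 1) (by omega)) B).tgt) ∧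
                ∀ ν, (B10Eq27TorusAxialLog.rel z ℓ'.src ν).natAbs ≤ 2) ∧
        (blockOf q.src = blockOf (bondShift (F.sitesPerDir_eq (m := F.m) (K := J + (t + 1)) (j := 0) (m' := F.m) (K' := K) (j' := (K - (J + (t + 1)))) (by omega)) ℓ').src ∨ blockOf q.src = (blockOf (bondShift (F.sitesPerDir_eq (m := F.m) (K := J + (t + 1)) (j := 0) (m' := F.m) (K' := K) (j' := (K - (J + (t + 1)))) (by omega)) ℓ').src).shift (bondShift (F.sitesPerDir_eq (m := F.m) (K := J + (t + 1)) (j := 0) (m' := F.m) (K' := K) (j' := (K - (J + (t + 1)))) (by omega)) ℓ').dir))) ∧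
          ∃ b : PBond (F.P K) (K - (J + (t + 1))), (b = ⟨q.src, q.μ⟩ ∨ b = ⟨q.src.shift q.μ, q.ν⟩ ∨ b = ⟨q.src.shift q.ν, q.μ⟩ ∨ b = ⟨q.src, q.ν⟩) ∧ wt (K - (J + (t + 1))) b e ≠ 0) then ‖logVec (su2Quat (GaugeField.gaugeAct (g ((K - (J + (t + 1))) + 1)) (Averaging.iter (fun k => blockAvg (P := F.P K) (j := k) ℰp) ((K - (J + (t + 1))) + 1) (fun ℓ => expPoint (ζ ℓ) * U₀ ℓ)) e * (GaugeField.gaugeAct (g₀ ((K - (J + (t + 1))) + 1)) (Averaging.iter (fun k => blockAvg (P := F.P K) (j := k) ℰp) ((K - (J + (t + 1))) + 1) U₁) e)⁻¹))‖ else 0)‖) else 0) t B) ^ 2 ≤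
        ((11 / 10) ^ 2 * (((F.P K).L : ℝ)⁻¹) ^ 2 * ((2 * (F.P J).d * (2 * (3 + 3) + 1) ^ (F.P J).d : ℕ) : ℝ)) * ((F.L : ℝ) ^ t * (if ht : t < K - J then
          ∑ B : PBond (F.P J) 0,
            ‖(fun ℓ' : PBond (F.P (J + t)) 0 =>
              if ∃ z : Site (F.P (J + t)) 0,
                (B14.Eq22Determines.blockIter t z = (bondShift (F.sitesPerDir_eq (m := F.m) (K := J) (j := 0) (m' := F.m) (K' := J + t) (j' := t) (by omega)) B).src ∨ B14.Eq22Determines.blockIter t z = (bondShift (F.sitesPerDir_eq (m := F.m) (K := J) (j := 0) (m' := F.m) (K' := J + t) (j' := t) (by omega)) B).tgt) ∧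
                ∀ ν, (B10Eq27TorusAxialLog.rel z ℓ'.src ν).natAbs ≤ 2
              then logVec (su2Quat (descendTo F ℰp (J + t) K (by omega) (fun ℓ => expPoint (ζ ℓ) * U₀ ℓ : GaugeField (F.P K) 0 (Matrix.specialUnitaryGroup (Fin 2) ℂ)) ℓ' * (descendTo F ℰp (J + t) K (by omega) U₀ ℓ')⁻¹)) else 0)‖ ^ 2
        else 0)) := by
    intro t hmem
    have ht : t < K - J := Finset.mem_range.mp hmem
    have hLt : (0 : ℝ) ≤ (F.L : ℝ) ^ t := by positivity
    simp only [dif_pos ht]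
    have hB : ∀ B : PBond (F.P J) 0, (11 / 10 * (((F.P K).L : ℝ)⁻¹ * ‖(fun e : PBond (F.P K) ((K - (J + (t + 1))) + 1) => if (∃ q : Plaq (F.P K) (K - (J + (t + 1))), ((∃ ℓ' : PBond (F.P (J + (t + 1))) 0, (∃ z : Site (F.P (J + (t + 1))) 0,
                (B14.Eq22Determines.blockIter (t + 1) z = (bondShift (F.sitesPerDir_eq (m := F.m) (K := J) (j := 0) (m' := F.m) (K' := J + (t + 1)) (j' := t + 1) (by omega)) B).src ∨ B14.Eq22Determines.blockIter (t + 1) z = (bondShift (F.sitesPerDir_eq (m := F.m) (K := J) (j := 0) (m' := F.m) (K' := J + (t + 1)) (j' := t + 1) (by omega)) B).tgt) ∧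
                ∀ ν, (B10Eq27TorusAxialLog.rel z ℓ'.src ν).natAbs ≤ 2) ∧
        (blockOf q.src = blockOf (bondShift (F.sitesPerDir_eq (m := F.m) (K := J + (t + 1)) (j := 0) (m' := F.m) (K' := K) (j' := (K - (J + (t + 1)))) (by omega)) ℓ').src ∨ blockOf q.src = (blockOf (bondShift (F.sitesPerDir_eq (m := F.m) (K := J + (t + 1)) (j := 0) (m' := F.m) (K' := K) (j' := (K - (J + (t + 1)))) (by omega)) ℓ').src).shift (bondShift (F.sitesPerDir_eq (m := F.m) (K := J + (t + 1)) (j := 0) (m' := F.m) (K' := K) (j' := (K - (J + (t + 1)))) (by omega)) ℓ').dir))) ∧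
          ∃ b : PBond (F.P K) (K - (J + (t + 1))), (b = ⟨q.src, q.μ⟩ ∨ b = ⟨q.src.shift q.μ, q.ν⟩ ∨ b = ⟨q.src.shift q.ν, q.μ⟩ ∨ b = ⟨q.src, q.ν⟩) ∧ wt (K - (J + (t + 1))) b e ≠ 0) then ‖logVec (su2Quat (GaugeField.gaugeAct (g ((K - (J + (t + 1))) + 1)) (Averaging.iter (fun k => blockAvg (P := F.P K) (j := k) ℰp) ((K - (J + (t + 1))) + 1) (fun ℓ => expPoint (ζ ℓ) * U₀ ℓ)) e * (GaugeField.gaugeAct (g₀ ((K - (J + (t + 1))) + 1)) (Averaging.iter (fun k => blockAvg (P := F.P K) (j := k) ℰp) ((K - (J + (t + 1))) + 1) U₁) e)⁻¹))‖ else 0)‖)) ^ 2 ≤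
        ((11 / 10) ^ 2 * (((F.P K).L : ℝ)⁻¹) ^ 2) * ‖(fun c : PBond (F.P (J + t)) 0 =>
        if ∃ ℓ' : PBond (F.P (J + (t + 1))) 0, (∃ ℓ'' : PBond (F.P (J + (t + 1))) 0, (∃ z : Site (F.P (J + (t + 1))) 0,
                (B14.Eq22Determines.blockIter (t + 1) z = (bondShift (F.sitesPerDir_eq (m := F.m) (K := J) (j := 0) (m' := F.m) (K' := J + (t + 1)) (j' := t + 1) (by omega)) B).src ∨ B14.Eq22Determines.blockIter (t + 1) z = (bondShift (F.sitesPerDir_eq (m := F.m) (K := J) (j := 0) (m' := F.m) (K' := J + (t + 1)) (j' := t + 1) (by omega)) B).tgt) ∧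
                ∀ ν, (B10Eq27TorusAxialLog.rel z ℓ''.src ν).natAbs ≤ 2) ∧
                (blockOf ℓ'.src = (blockOf ℓ''.src).unshift ℓ''.dir ∨ blockOf ℓ'.src = blockOf ℓ''.src ∨ blockOf ℓ'.src = (blockOf ℓ''.src).shift ℓ''.dir)) ∧
                ∀ ν, (B10Eq27TorusAxialLog.rel ((siteShift (F.sitesPerDir_eq (m := F.m) (K := J + t) (j := 0) (m' := F.m) (K' := J + (t + 1)) (j' := 1) (by omega))).symm (blockOf ℓ'.src)) c.src ν).natAbs ≤ 3
        then logVec (su2Quat (descendTo F ℰp (J + t) K (by omega) (fun ℓ => expPoint (ζ ℓ) * U₀ ℓ : GaugeField (F.P K) 0 (Matrix.specialUnitaryGroup (Fin 2) ℂ)) c * (descendTo F ℰp (J + t) K (by omega) U₀ c)⁻¹)) else 0)‖ ^ 2 := by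
      intro B
      have hM := pow_le_pow_left₀ (norm_nonneg _) (mCApar_le_parentBoxSup U₀ ζ wt U₁ g g₀ hwt hT3 hT3' hU₀ t ht B) 2
      calc (11 / 10 * (((F.P K).L : ℝ)⁻¹ * ‖(fun e : PBond (F.P K) ((K - (J + (t + 1))) + 1) => if (∃ q : Plaq (F.P K) (K - (J + (t + 1))), ((∃ ℓ' : PBond (F.P (J + (t + 1))) 0, (∃ z : Site (F.P (J + (t + 1))) 0,
                (B14.Eq22Determines.blockIter (t + 1) z = (bondShift (F.sitesPerDir_eq (m := F.m) (K := J) (j := 0) (m' := F.m) (K' := J + (t + 1)) (j' := t + 1) (by omega)) B).src ∨ B14.Eq22Determines.blockIter (t + 1) z = (bondShift (F.sitesPerDir_eq (m := F.m) (K := J) (j := 0) (m' := F.m) (K' := J + (t + 1)) (j' := t + 1) (by omega)) B).tgt) ∧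
                ∀ ν, (B10Eq27TorusAxialLog.rel z ℓ'.src ν).natAbs ≤ 2) ∧
        (blockOf q.src = blockOf (bondShift (F.sitesPerDir_eq (m := F.m) (K := J + (t + 1)) (j := 0) (m' := F.m) (K' := K) (j' := (K - (J + (t + 1)))) (by omega)) ℓ').src ∨ blockOf q.src = (blockOf (bondShift (F.sitesPerDir_eq (m := F.m) (K := J + (t + 1)) (j := 0) (m' := F.m) (K' := K) (j' := (K - (J + (t + 1)))) (by omega)) ℓ').src).shift (bondShift (F.sitesPerDir_eq (m := F.m) (K := J + (t + 1)) (j := 0) (m' := F.m) (K' := K) (j' := (K - (J + (t + 1)))) (by omega)) ℓ').dir))) ∧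
          ∃ b : PBond (F.P K) (K - (J + (t + 1))), (b = ⟨q.src, q.μ⟩ ∨ b = ⟨q.src.shift q.μ, q.ν⟩ ∨ b = ⟨q.src.shift q.ν, q.μ⟩ ∨ b = ⟨q.src, q.ν⟩) ∧ wt (K - (J + (t + 1))) b e ≠ 0) then ‖logVec (su2Quat (GaugeField.gaugeAct (g ((K - (J + (t + 1))) + 1)) (Averaging.iter (fun k => blockAvg (P := F.P K) (j := k) ℰp) ((K - (J + (t + 1))) + 1) (fun ℓ => expPoint (ζ ℓ) * U₀ ℓ)) e * (GaugeField.gaugeAct (g₀ ((K - (J + (t + 1))) + 1)) (Averaging.iter (fun k => blockAvg (P := F.P K) (j := k) ℰp) ((K - (J + (t + 1))) + 1) U₁) e)⁻¹))‖ else 0)‖)) ^ 2 = ((11 / 10) ^ 2 * (((F.P K).L : ℝ)⁻¹) ^ 2) * ‖(fun e : PBond (F.P K) ((K - (J + (t + 1))) + 1) => if (∃ q : Plaq (F.P K) (K - (J + (t + 1))), ((∃ ℓ' : PBond (F.P (J + (t + 1))) 0, (∃ z : Site (F.P (J + (t + 1))) 0,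
                (B14.Eq22Determines.blockIter (t + 1) z = (bondShift (F.sitesPerDir_eq (m := F.m) (K := J) (j := 0) (m' := F.m) (K' := J + (t + 1)) (j' := t + 1) (by omega)) B).src ∨ B14.Eq22Determines.blockIter (t + 1) z = (bondShift (F.sitesPerDir_eq (m := F.m) (K := J) (j := 0) (m' := F.m) (K' := J + (t + 1)) (j' := t + 1) (by omega)) B).tgt) ∧
                ∀ ν, (B10Eq27TorusAxialLog.rel z ℓ'.src ν).natAbs ≤ 2) ∧
        (blockOf q.src = blockOf (bondShift (F.sitesPerDir_eq (m := F.m) (K := J + (t + 1)) (j := 0) (m' := F.m) (K' := K) (j' := (K - (J + (t + 1)))) (by omega)) ℓ').src ∨ blockOf q.src = (blockOf (bondShift (F.sitesPerDir_eq (m := F.m) (K := J + (t + 1)) (j := 0) (m' := F.m) (K' := K) (j' := (K - (J + (t + 1)))) (by omega)) ℓ').src).shift (bondShift (F.sitesPerDir_eq (m := F.m) (K := J + (t + 1)) (j := 0) (m' := F.m) (K' := K) (j' := (K - (J + (t + 1)))) (by omega)) ℓ').dir))) ∧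
          ∃ b : PBond (F.P K) (K - (J + (t + 1))), (b = ⟨q.src, q.μ⟩ ∨ b = ⟨q.src.shift q.μ, q.ν⟩ ∨ b = ⟨q.src.shift q.ν, q.μ⟩ ∨ b = ⟨q.src, q.ν⟩) ∧ wt (K - (J + (t + 1))) b e ≠ 0) then ‖logVec (su2Quat (GaugeField.gaugeAct (g ((K - (J + (t + 1))) + 1)) (Averaging.iter (fun k => blockAvg (P := F.P K) (j := k) ℰp) ((K - (J + (t + 1))) + 1) (fun ℓ => expPoint (ζ ℓ) * U₀ ℓ)) e * (GaugeField.gaugeAct (g₀ ((K - (J + (t + 1))) + 1)) (Averaging.iter (fun k => blockAvg (P := F.P K) (j := k) ℰp) ((K - (J + (t + 1))) + 1) U₁) e)⁻¹))‖ else 0)‖ ^ 2 := by ring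
        _ ≤ _ := mul_le_mul_of_nonneg_left hM (by positivity)
    have hsumB := Finset.sum_le_sum fun B (_ : B ∈ Finset.univ) => hB B
    rw [← Finset.mul_sum] at hsumB
    have hcov : ∑ B : PBond (F.P J) 0, ‖(fun c : PBond (F.P (J + t)) 0 =>
        if ∃ ℓ' : PBond (F.P (J + (t + 1))) 0, (∃ ℓ'' : PBond (F.P (J + (t + 1))) 0, (∃ z : Site (F.P (J + (t + 1))) 0,
                (B14.Eq22Determines.blockIter (t + 1) z = (bondShift (F.sitesPerDir_eq (m := F.m) (K := J) (j := 0) (m' := F.m) (K' := J + (t + 1)) (j' := t + 1) (by omega)) B).src ∨ B14.Eq22Determines.blockIter (t + 1) z = (bondShift (F.sitesPerDir_eq (m := F.m) (K := J) (j := 0) (m' := F.m) (K' := J + (t + 1)) (j' := t + 1) (by omega)) B).tgt) ∧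
                ∀ ν, (B10Eq27TorusAxialLog.rel z ℓ''.src ν).natAbs ≤ 2) ∧
                (blockOf ℓ'.src = (blockOf ℓ''.src).unshift ℓ''.dir ∨ blockOf ℓ'.src = blockOf ℓ''.src ∨ blockOf ℓ'.src = (blockOf ℓ''.src).shift ℓ''.dir)) ∧
                ∀ ν, (B10Eq27TorusAxialLog.rel ((siteShift (F.sitesPerDir_eq (m := F.m) (K := J + t) (j := 0) (m' := F.m) (K' := J + (t + 1)) (j' := 1) (by omega))).symm (blockOf ℓ'.src)) c.src ν).natAbs ≤ 3
        then logVec (su2Quat (descendTo F ℰp (J + t) K (by omega) (fun ℓ => expPoint (ζ ℓ) * U₀ ℓ : GaugeField (F.P K) 0 (Matrix.specialUnitaryGroup (Fin 2) ℂ)) c * (descendTo F ℰp (J + t) K (by omega) U₀ c)⁻¹)) else 0)‖ ^ 2 ≤ ((2 * (F.P J).d * (2 * (3 + 3) + 1) ^ (F.P J).d : ℕ) : ℝ) * ∑ B : PBond (F.P J) 0, ‖(fun ℓ' : PBond (F.P (J + t)) 0 =>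
              if ∃ z : Site (F.P (J + t)) 0,
                (B14.Eq22Determines.blockIter t z = (bondShift (F.sitesPerDir_eq (m := F.m) (K := J) (j := 0) (m' := F.m) (K' := J + t) (j' := t) (by omega)) B).src ∨ B14.Eq22Determines.blockIter t z = (bondShift (F.sitesPerDir_eq (m := F.m) (K := J) (j := 0) (m' := F.m) (K' := J + t) (j' := t) (by omega)) B).tgt) ∧
                ∀ ν, (B10Eq27TorusAxialLog.rel z ℓ'.src ν).natAbs ≤ 2
              then logVec (su2Quat (descendTo F ℰp (J + t) K (by omega) (fun ℓ => expPoint (ζ ℓ) * U₀ ℓ : GaugeField (F.P K) 0 (Matrix.specialUnitaryGroup (Fin 2) ℂ)) ℓ' * (descendTo F ℰp (J + t) K (by omega) U₀ ℓ')⁻¹)) else 0)‖ ^ 2 := by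
      simpa only using sum_sq_parentBoxSup_le_readSup (F := F) J t 3 (fun c : PBond (F.P (J + t)) 0 => logVec (su2Quat (descendTo F ℰp (J + t) K (by omega) (fun ℓ => expPoint (ζ ℓ) * U₀ ℓ : GaugeField (F.P K) 0 (Matrix.specialUnitaryGroup (Fin 2) ℂ)) c * (descendTo F ℰp (J + t) K (by omega) U₀ c)⁻¹)))
    calc (F.L : ℝ) ^ t * ∑ B : PBond (F.P J) 0, (11 / 10 * (((F.P K).L : ℝ)⁻¹ * ‖(fun e : PBond (F.P K) ((K - (J + (t + 1))) + 1) => if (∃ q : Plaq (F.P K) (K - (J + (t + 1))), ((∃ ℓ' : PBond (F.P (J + (t + 1))) 0, (∃ z : Site (F.P (J + (t + 1))) 0,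
                (B14.Eq22Determines.blockIter (t + 1) z = (bondShift (F.sitesPerDir_eq (m := F.m) (K := J) (j := 0) (m' := F.m) (K' := J + (t + 1)) (j' := t + 1) (by omega)) B).src ∨ B14.Eq22Determines.blockIter (t + 1) z = (bondShift (F.sitesPerDir_eq (m := F.m) (K := J) (j := 0) (m' := F.m) (K' := J + (t + 1)) (j' := t + 1) (by omega)) B).tgt) ∧
                ∀ ν, (B10Eq27TorusAxialLog.rel z ℓ'.src ν).natAbs ≤ 2) ∧
        (blockOf q.src = blockOf (bondShift (F.sitesPerDir_eq (m := F.m) (K := J + (t + 1)) (j := 0) (m' := F.m) (K' := K) (j' := (K - (J + (t + 1)))) (by omega)) ℓ').src ∨ blockOf q.src = (blockOf (bondShift (F.sitesPerDir_eq (m := F.m) (K := J + (t + 1)) (j := 0) (m' := F.m) (K' := K) (j' := (K - (J + (t + 1)))) (by omega)) ℓ').src).shift (bondShift (F.sitesPerDir_eq (m := F.m) (K := J + (t + 1)) (j := 0) (m' := F.m) (K' := K) (j' := (K - (J + (t + 1)))) (by omega)) ℓ').dir))) ∧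
          ∃ b : PBond (F.P K) (K - (J + (t + 1))), (b = ⟨q.src, q.μ⟩ ∨ b = ⟨q.src.shift q.μ, q.ν⟩ ∨ b = ⟨q.src.shift q.ν, q.μ⟩ ∨ b = ⟨q.src, q.ν⟩) ∧ wt (K - (J + (t + 1))) b e ≠ 0) then ‖logVec (su2Quat (GaugeField.gaugeAct (g ((K - (J + (t + 1))) + 1)) (Averaging.iter (fun k => blockAvg (P := F.P K) (j := k) ℰp) ((K - (J + (t + 1))) + 1) (fun ℓ => expPoint (ζ ℓ) * U₀ ℓ)) e * (GaugeField.gaugeAct (g₀ ((K - (J + (t + 1))) + 1)) (Averaging.iter (fun k => blockAvg (P := F.P K) (j := k) ℰp) ((K - (J + (t + 1))) + 1) U₁) e)⁻¹))‖ else 0)‖)) ^ 2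
        ≤ (F.L : ℝ) ^ t * (((11 / 10) ^ 2 * (((F.P K).L : ℝ)⁻¹) ^ 2) * (((2 * (F.P J).d * (2 * (3 + 3) + 1) ^ (F.P J).d : ℕ) : ℝ) * ∑ B : PBond (F.P J) 0, ‖(fun ℓ' : PBond (F.P (J + t)) 0 =>
              if ∃ z : Site (F.P (J + t)) 0,
                (B14.Eq22Determines.blockIter t z = (bondShift (F.sitesPerDir_eq (m := F.m) (K := J) (j := 0) (m' := F.m) (K' := J + t) (j' := t) (by omega)) B).src ∨ B14.Eq22Determines.blockIter t z = (bondShift (F.sitesPerDir_eq (m := F.m) (K := J) (j := 0) (m' := F.m) (K' := J + t) (j' := t) (by omega)) B).tgt) ∧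
                ∀ ν, (B10Eq27TorusAxialLog.rel z ℓ'.src ν).natAbs ≤ 2
              then logVec (su2Quat (descendTo F ℰp (J + t) K (by omega) (fun ℓ => expPoint (ζ ℓ) * U₀ ℓ : GaugeField (F.P K) 0 (Matrix.specialUnitaryGroup (Fin 2) ℂ)) ℓ' * (descendTo F ℰp (J + t) K (by omega) U₀ ℓ')⁻¹)) else 0)‖ ^ 2)) :=
          mul_le_mul_of_nonneg_left (hsumB.trans (mul_le_mul_of_nonneg_left hcov (by positivity))) hLt
      _ = _ := by ring
  have hsum := Finset.sum_le_sum hlev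
  rw [← Finset.mul_sum] at hsum
  have hM := mShare_le hJK U₀ ζ hmate
  have h2 := mul_le_mul_of_nonneg_left hM (show (0 : ℝ) ≤ (11 / 10) ^ 2 * (((F.P K).L : ℝ)⁻¹) ^ 2 * ((2 * (F.P J).d * (2 * (3 + 3) + 1) ^ (F.P J).d : ℕ) : ℝ) by positivity)
  calc _ ≤ _ := hsum
    _ ≤ ((11 / 10) ^ 2 * (((F.P K).L : ℝ)⁻¹) ^ 2 * ((2 * (F.P J).d * (2 * (3 + 3) + 1) ^ (F.P J).d : ℕ) : ℝ)) * ((F.L : ℝ) * (∑ t ∈ Finset.range (K - J), (if ht : t < K - J then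
          (F.L : ℝ) ^ t * ∑ B : PBond (F.P J) 0,
            ‖(fun ℓ' : PBond (F.P (J + (t + 1))) 0 =>
              if ∃ z : Site (F.P (J + (t + 1))) 0,
                (B14.Eq22Determines.blockIter (t + 1) z = (bondShift (F.sitesPerDir_eq (m := F.m) (K := J) (j := 0) (m' := F.m) (K' := J + (t + 1)) (j' := t + 1) (by omega)) B).src ∨ B14.Eq22Determines.blockIter (t + 1) z = (bondShift (F.sitesPerDir_eq (m := F.m) (K := J) (j := 0) (m' := F.m) (K' := J + (t + 1)) (j' := t + 1) (by omega)) B).tgt) ∧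
                ∀ ν, (B10Eq27TorusAxialLog.rel z ℓ'.src ν).natAbs ≤ 2
              then logVec (su2Quat (descendTo F ℰp (J + (t + 1)) K (by omega) (fun ℓ => expPoint (ζ ℓ) * U₀ ℓ : GaugeField (F.P K) 0 (Matrix.specialUnitaryGroup (Fin 2) ℂ)) ℓ' * (descendTo F ℰp (J + (t + 1)) K (by omega) U₀ ℓ')⁻¹)) else 0)‖ ^ 2
        else 0))) := h2
    _ = _ := by ring

end Tower

end Summit.QuantumFields.YangMills.Theorems.FluctuationComparisonRegPrIntLS2BetaMAColumn
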